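import Summits.ResolutionOfSingularities.ResolutionOfSingularities.Theorems.PurelyInseparableDim4EquimultipleScope
import Literature.AlgebraicGeometry.Resolution.CentreBlowupOrdAlongBasics
import HarnessLib

/-!
# Slice-B brick (K5(b)): one-direction Hasse derivatives commute with shears, point-chart transforms and free factors

[OURS · counted 0 · polynomial bookkeeping]  Nothing here is a statement about resolution of singularities in dimension
≥ 4 / characteristic `p`, which is NOT proved.  Cell `res-dim4-pi`, K2(p) lane, SLICE B architecture of record
(res-dim4-p-12 g3 `SLICE-B-ARCH-g3.md` 0430a5173a152fb1 §2 (K5)(b); desk g2 WORD #88 (a)); the four identities the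
HASSE CONTACT law `D_f^{(d−1)} G′ = (units) · chartTransform 1 univ j (shear j b (D_f^{(d−1)} G))` is assembled from
(signatures posted by the lane holder, bus 2026-08-28T23:08:06Z (iii)):

* `hasseDeriv_single_shear` — `D_f^{(n)} (shear j b P) = shear j b (D_f^{(n)} P)` for `f ≠ j` (the shear
  `x_i ↦ x_i + b_i x_j` touches `x_f` only through `x_f ↦ x_f + b_f x_j`; proof: Taylor morphism modulo the outer `u_j`);
* `hasseDeriv_single_chartTransform` — `D_f^{(n)} (chartTransform m univ j Q) = chartTransform (m − n) univ j (D_f^{(n)} Q)`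
  for `f ≠ j`, `n ≤ m` (monomialwise: the chart law moves only the `j`-th exponent, `D_f^{(n)}` only the `f`-th);
* `hasseDeriv_single_mul_of_free` — `D_f^{(n)} (P · Q) = P · D_f^{(n)} Q` when `x_f` does not occur in `P` (Leibniz);
* `hasseDeriv_single_monomial_eq_zero_of_dvd` — `D_f^{(n)} (c x^E) = 0` for `0 < n < p`, `p ∣ E_f` (Lucas).

`hasseDeriv` is the frame's `PIDim4.hasseDeriv` (`…Scope`, = the tree's `Resolution.hasseDeriv` by
`Equimultiple.hasseDeriv_eq`); `shear` is `Hauser2010.shear`; `chartTransform` is `CentreBlowup.chartTransform`.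
General-index versions over the Literature operator are proved first (`…'`).  Typed and proved by res-dim4-typ-1 (g2)
on the lane holder's call.  Supports stmt-ResolutionOfSingularities-16155 (helper).
bears_on: LADDER-RESOLUTION:D157-DOOR2 (res-dim4-pi · K2(p) slice B · K5(b)).
-/

set_option linter.dupNamespace false -- mandated namespace of this single-conjunct summit

namespace Summit.ResolutionOfSingularities.ResolutionOfSingularities.Theorems.PIDim4

namespace ResCone

open MvPolynomial Finset
open Literature.AlgebraicGeometry.Resolution
open Literature.AlgebraicGeometry.Resolution.Hauser2010
open Literature.AlgebraicGeometry.Resolution.CentreBlowup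

/-! ## §0 Killing one variable -/

section Kill

variable {R : Type*} [CommRing R] {τ : Type*} [DecidableEq τ]

/-- `x_j ∣ Q − Q|_{x_j = 0}` for the substitution `x_j ↦ 0`. [folklore] -/
theorem X_dvd_sub_aeval_kill (j : τ) (Q : MvPolynomial τ R) :
    (X j : MvPolynomial τ R) ∣ Q - MvPolynomial.aeval (fun i => if i = j then (0 : MvPolynomial τ R) else X i) Q := by
  induction Q using MvPolynomial.induction_on with
  | C c => exact ⟨0, by simp⟩
  | add P Q hP hQ =>
    obtain ⟨g, hg⟩ := hP
    obtain ⟨g', hg'⟩ := hQ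
    exact ⟨g + g', by rw [map_add]; linear_combination hg + hg'⟩
  | mul_X P i hP =>
    obtain ⟨g, hg⟩ := hP
    by_cases hij : i = j
    · subst hij
      refine ⟨P, ?_⟩
      rw [map_mul, MvPolynomial.aeval_X, if_pos rfl, mul_zero, sub_zero, mul_comm]
    · refine ⟨g * X i, ?_⟩
      rw [map_mul, MvPolynomial.aeval_X, if_neg hij]
      linear_combination (X i : MvPolynomial τ R) * hg

/-- Coefficients of monomials not involving `x_j` are unchanged by `x_j ↦ 0`. [folklore] -/
theorem coeff_aeval_kill_of_apply_eq_zero (j : τ) (Q : MvPolynomial τ R) {m : τ →₀ ℕ} (hm : m j = 0) :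
    coeff m (MvPolynomial.aeval (fun i => if i = j then (0 : MvPolynomial τ R) else X i) Q) = coeff m Q := by
  obtain ⟨g, hg⟩ := X_dvd_sub_aeval_kill j Q
  have h : coeff m (Q - MvPolynomial.aeval (fun i => if i = j then (0 : MvPolynomial τ R) else X i) Q) = 0 := by
    rw [hg, coeff_X_mul', if_neg (by rw [Finsupp.mem_support_iff, hm]; exact fun h => h rfl)]
  rw [coeff_sub, sub_eq_zero] at h
  exact h.symm

end Kill

/-! ## §1 Hasse derivatives in one direction commute with shears (general index type, Literature operator) -/

section Lit

variable {σ : Type*} [DecidableEq σ] {K : Type*} [Field K]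

/-- `D_f^{(n)} (shear j b P) = shear j b (D_f^{(n)} P)` for `f ≠ j` (the tree's operator `Resolution.hasseDeriv`).
Proof: with the Taylor morphism `τ : P ↦ P(x + u)` and the shear `φ`, `τ ∘ φ` and `map φ ∘ τ` agree modulo the outer
variable `u_j` (only `x_j` is sheared into the other variables), and the coefficient of `u_f^n` does not see `u_j`.
[folklore] -/
theorem hasseDeriv_single_shear' {f j : σ} (hfj : f ≠ j) (b : σ → K) (n : ℕ) (P : MvPolynomial σ K) :
    Literature.AlgebraicGeometry.Resolution.hasseDeriv K (Finsupp.single f n) (shear j b P) =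
      shear j b (Literature.AlgebraicGeometry.Resolution.hasseDeriv K (Finsupp.single f n) P) := by
  unfold shear
  set φ : MvPolynomial σ K →ₐ[K] MvPolynomial σ K :=
    aeval fun i => if i = j then (X j : MvPolynomial σ K) else X i + C (b i) * X j with hφ
  set κ : MvPolynomial σ (MvPolynomial σ K) →ₐ[MvPolynomial σ K] MvPolynomial σ (MvPolynomial σ K) :=
    aeval fun i => if i = j then (0 : MvPolynomial σ (MvPolynomial σ K)) else X i with hκ
  have hφC : ∀ c : K, φ (C c) = C c := fun c => by rw [hφ, algHom_C, algebraMap_eq]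
  have hκC : ∀ r : MvPolynomial σ K, κ (C r) = C r := fun r => by rw [hκ, algHom_C, MvPolynomial.algebraMap_eq]
  have hκXj : κ (X j) = 0 := by rw [hκ, aeval_X, if_pos rfl]
  have hκX : ∀ i, i ≠ j → κ (X i) = X i := fun i hi => by rw [hκ, aeval_X, if_neg hi]
  have key : κ.toRingHom.comp ((taylor K (σ := σ)).toRingHom.comp φ.toRingHom) =
      κ.toRingHom.comp ((MvPolynomial.map φ.toRingHom).comp (taylor K (σ := σ)).toRingHom) := by
    refine MvPolynomial.ringHom_ext (fun c => ?_) (fun i => ?_)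
    · simp only [RingHom.comp_apply, AlgHom.toRingHom_eq_coe, RingHom.coe_coe, hφC, taylor_C, map_C]
    · by_cases hij : i = j
      · subst hij
        have h1 : φ (X i) = X i := by rw [hφ, aeval_X, if_pos rfl]
        simp only [RingHom.comp_apply, AlgHom.toRingHom_eq_coe, RingHom.coe_coe, h1, taylor_X, map_add, map_C,
          map_X, hκC, hκXj]
      · have h1 : φ (X i) = X i + C (b i) * X j := by rw [hφ, aeval_X, if_neg hij]
        simp only [RingHom.comp_apply, AlgHom.toRingHom_eq_coe, RingHom.coe_coe, h1, taylor_X, taylor_C, map_add,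
          map_mul, map_C, map_X, hκC, hκXj, hκX i hij, mul_add, mul_zero, add_zero]
        ring
  have key' := RingHom.congr_fun key P
  simp only [RingHom.comp_apply, AlgHom.toRingHom_eq_coe, RingHom.coe_coe] at key'
  have hs : (Finsupp.single f n : σ →₀ ℕ) j = 0 := by rw [Finsupp.single_apply, if_neg hfj]
  rw [hasseDeriv_apply, hasseDeriv_apply, ← coeff_aeval_kill_of_apply_eq_zero j (taylor K (φ P)) hs,
    show MvPolynomial.aeval (fun i => if i = j then (0 : MvPolynomial σ (MvPolynomial σ K)) else X i) (taylor K (φ P)) =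
      κ (taylor K (φ P)) from rfl, key',
    show κ ((MvPolynomial.map (φ : MvPolynomial σ K →+* MvPolynomial σ K)) (taylor K P)) =
      MvPolynomial.aeval (fun i => if i = j then (0 : MvPolynomial σ (MvPolynomial σ K)) else X i)
        ((MvPolynomial.map (φ : MvPolynomial σ K →+* MvPolynomial σ K)) (taylor K P)) from rfl,
    coeff_aeval_kill_of_apply_eq_zero j _ hs, coeff_map, RingHom.coe_coe]

end Lit

/-! ## §2 The frame's versions on `Fin 4` -/

variable {K : Type} [Field K]

/-- **`D_f^{(n)} (shear j b P) = shear j b (D_f^{(n)} P)`** (`f ≠ j`). [folklore] -/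
theorem hasseDeriv_single_shear {f j : Fin 4} (hfj : f ≠ j) (b : Fin 4 → K) (n : ℕ) (P : MvPolynomial (Fin 4) K) :
    hasseDeriv (Finsupp.single f n) (shear j b P) = shear j b (hasseDeriv (Finsupp.single f n) P) := by
  rw [Equimultiple.hasseDeriv_eq, Equimultiple.hasseDeriv_eq]
  exact hasseDeriv_single_shear' hfj b n P

/-- `|e − n·e_f| = |e| − n` when `n ≤ e_f`. [folklore] -/
theorem degree_sub_single {σ : Type*} {e : σ →₀ ℕ} {f : σ} {n : ℕ} (h : n ≤ e f) :
    (e - Finsupp.single f n).degree = e.degree - n := by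
  have h1 : e - Finsupp.single f n + Finsupp.single f n = e := tsub_add_cancel_of_le (Finsupp.single_le_iff.mpr h)
  have h2 := congrArg Finsupp.degree h1
  rw [map_add, Finsupp.degree_single] at h2
  omega

/-- **`D_f^{(n)} (chartTransform m univ j Q) = chartTransform (m − n) univ j (D_f^{(n)} Q)`** (`f ≠ j`, `n ≤ m`):
the point-chart law changes only the `j`-th exponent, `D_f^{(n)}` only the `f`-th (with the factor `(e_f choose n)`).
[folklore] -/
theorem hasseDeriv_single_chartTransform {f j : Fin 4} (hfj : f ≠ j) {n m : ℕ} (hnm : n ≤ m)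
    (Q : MvPolynomial (Fin 4) K) :
    hasseDeriv (Finsupp.single f n) (chartTransform m Finset.univ j Q) =
      chartTransform (m - n) Finset.univ j (hasseDeriv (Finsupp.single f n) Q) := by
  have hQ := Q.as_sum
  conv_lhs => rw [hQ]
  conv_rhs => rw [hQ]
  rw [chartTransform_sum, Equimultiple.hasseDeriv_eq, map_sum, Equimultiple.hasseDeriv_eq, map_sum, chartTransform_sum]
  refine Finset.sum_congr rfl fun e _ => ?_
  rw [chartTransform_monomial, hasseDeriv_single_monomial, hasseDeriv_single_monomial, chartTransform_monomial,
    chartExponent_apply_of_ne m Finset.univ hfj]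
  by_cases hlt : e f < n
  · rw [Nat.choose_eq_zero_of_lt hlt, Nat.cast_zero, mul_zero]
    simp
  · push Not at hlt
    have hexp : chartExponent m Finset.univ j e - Finsupp.single f n =
        chartExponent (m - n) Finset.univ j (e - Finsupp.single f n) := by
      ext i
      rw [Finsupp.tsub_apply, chartExponent_apply, chartExponent_apply, Finsupp.tsub_apply, Finsupp.single_apply,
        degIn_univ, degIn_univ, degree_sub_single hlt]
      by_cases hij : i = j
      · rw [if_pos hij, if_pos hij, if_neg (fun h : f = i => hfj (h.trans hij))]
        omega
      · rw [if_neg hij, if_neg hij]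
    rw [hexp]

/-- **`D_f^{(n)} (P · Q) = P · D_f^{(n)} Q` when `x_f` does not occur in `P`** (higher Leibniz rule; every other term
carries some `D_f^{(k)} P`, `k ≥ 1`, which vanishes). [folklore] -/
theorem hasseDeriv_single_mul_of_free {f : Fin 4} {P : MvPolynomial (Fin 4) K} (hP : ∀ e ∈ P.support, e f = 0)
    (n : ℕ) (Q : MvPolynomial (Fin 4) K) :
    hasseDeriv (Finsupp.single f n) (P * Q) = P * hasseDeriv (Finsupp.single f n) Q := by
  rw [Equimultiple.hasseDeriv_eq, Equimultiple.hasseDeriv_eq, Literature.AlgebraicGeometry.Resolution.hasseDeriv_mul,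
    Finset.sum_eq_single (0, Finsupp.single f n)]
  · rw [hasseDeriv_zero_apply]
  · rintro ⟨β, γ⟩ hmem hne
    have hsum : β + γ = Finsupp.single f n := Finset.HasAntidiagonal.mem_antidiagonal.mp hmem
    -- `β ≠ 0`, and `β ≤ n e_f` is supported at `f`
    have hβf : 1 ≤ β f := by
      by_contra hlt
      push Not at hlt
      have hβ0 : β = 0 := by
        ext i
        have hi := DFunLike.congr_fun hsum i
        rw [Finsupp.coe_add, Pi.add_apply, Finsupp.single_apply] at hi
        by_cases hif : f = i
        · subst hif; rw [Finsupp.coe_zero, Pi.zero_apply]; omega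
        · rw [if_neg hif] at hi
          rw [Finsupp.coe_zero, Pi.zero_apply]; omega
      apply hne
      rw [hβ0, zero_add] at hsum
      rw [hβ0, hsum]
    suffices h : Literature.AlgebraicGeometry.Resolution.hasseDeriv K β P = 0 by rw [h, zero_mul]
    ext m
    rw [coeff_hasseDeriv, coeff_zero]
    have hnot : β + m ∉ P.support := fun hmem' => by
      have := hP _ hmem'
      rw [Finsupp.coe_add, Pi.add_apply] at this
      omega
    rw [MvPolynomial.notMem_support_iff.mp hnot, mul_zero]
  · intro h
    exact absurd (Finset.HasAntidiagonal.mem_antidiagonal.mpr (zero_add _)) h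

/-- **`D_f^{(n)} (c · x^E) = 0` for `0 < n < p` and `p ∣ E_f`** (Lucas: `(E_f choose n) ≡ (0 choose n) · … = 0 mod p`).
[folklore] -/
theorem hasseDeriv_single_monomial_eq_zero_of_dvd (p : ℕ) [Fact p.Prime] [CharP K p] {f : Fin 4} {n : ℕ}
    (hn0 : 0 < n) (hnp : n < p) {E : Fin 4 →₀ ℕ} (hE : p ∣ E f) (c : K) :
    hasseDeriv (Finsupp.single f n) (monomial E c) = 0 := by
  rw [Equimultiple.hasseDeriv_eq, hasseDeriv_single_monomial]
  have hchoose : (((E f).choose n : ℕ) : K) = 0 := by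
    rw [CharP.cast_eq_zero_iff K p]
    have hmod := Choose.choose_modEq_choose_mod_mul_choose_div_nat (n := E f) (k := n) (p := p)
    rw [Nat.mod_eq_zero_of_dvd hE, Nat.mod_eq_of_lt hnp, Nat.choose_eq_zero_of_lt hn0, zero_mul] at hmod
    exact Nat.modEq_zero_iff_dvd.mp hmod
  rw [hchoose, mul_zero, map_zero]

end ResCone

end Summit.ResolutionOfSingularities.ResolutionOfSingularities.Theorems.PIDim4
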